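import Literature.Topology.FourManifolds.GroupTrisections
import Mathlib.GroupTheory.QuotientGroup.Basic
import Mathlib.Algebra.Group.Subgroup.Pointwise
import HarnessLib

/-!
# `ShadowsStandard` / line power-twist-absorption — stub `stub_faceCharOfTrisection`

For a normalised genus-`3` group trisection `(N₀, N₁, K₂)` of the trivial group
(`K 0 = s4Kernels 0 = N₀ = ⟪a₁,a₂,b₃⟫`, `K 1 = s4Kernels 1 = N₁ = ⟪a₁,b₂,a₃⟫`), the face
`F₃ = S₃ ⧸ ⟪N₀ ∪ K₂⟫` is free of rank `1` (`free_pairQuotient 0 2`), i.e. `≅ ℤ`; composing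
`S₃ ↠ F₃ ≅ F_1 ≅ ℤ` gives a surjective character `f : S₃ →* ℤ` with
`ker f = ⟪N₀ ∪ K₂⟫ = K₂ ⊔ N₀` (both normal), killing `a₁, a₂, b₃ ∈ N₀`, and with
`N₁ ⊔ ker f = N₀ ⊔ N₁ ⊔ K₂ ⊇ ⟪⋃ Kᵢ⟫ = ⊤` because the triple quotient is trivial.
Lean indices: `a i = SurfaceGroup.a i = aᵢ₊₁`, `b i = SurfaceGroup.b i = bᵢ₊₁`.
-/

-- the prescribed namespace `Summit.<P>.<Sub>.…` duplicates `SmoothPoincare4` (P = Sub)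
set_option linter.dupNamespace false

noncomputable section

namespace Summit.SmoothPoincare4.SmoothPoincare4.Theorems.ShadowsStandard.PowerTwistAbsorption

open Literature.Topology.FourManifolds Subgroup

/-- For normal subgroups `A, B`, the normal closure of `A ∪ B` is `A ⊔ B`. [folklore] -/
private theorem faceChar_normalClosure_union_eq_sup {G : Type*} [Group G] (A B : Subgroup G)
    [A.Normal] [B.Normal] : normalClosure ((A : Set G) ∪ B) = A ⊔ B :=
  le_antisymm
    (normalClosure_le_normal (N := A ⊔ B) (Set.union_subset
      (fun _ hx => (le_sup_left : A ≤ A ⊔ B) hx) (fun _ hx => (le_sup_right : B ≤ A ⊔ B) hx)))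
    (sup_le (fun _ hx => subset_normalClosure (Or.inl hx))
      (fun _ hx => subset_normalClosure (Or.inr hx)))

/-- If the triple quotient `S₃ ⧸ ⟪⋃ Kᵢ⟫` is the trivial group, then `⟪⋃ Kᵢ⟫ = ⊤`. [folklore] -/
private theorem faceChar_normalClosure_iUnion_eq_top (K : TrisectionKernels 3)
    (h : Nonempty (K.tripleQuotient ≃* (PUnit : Type))) :
    normalClosure (⋃ i, (K i : Set (SurfaceGroup 3))) = ⊤ := by
  obtain ⟨t⟩ := h
  haveI : Subsingleton K.tripleQuotient := t.toEquiv.subsingleton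
  exact QuotientGroup.subsingleton_iff.1 ‹Subsingleton K.tripleQuotient›

/-- **`stub_faceCharOfTrisection`** (genus `3`, def-free): for a `(3;1)` group trisection
`K = (N₀, N₁, K₂)` of the trivial group normalised in its first two slots
(`K 0 = s4Kernels 0`, `K 1 = s4Kernels 1`), there is a surjective character
`f : S₃ →* ℤ` killing `a₁, a₂, b₃` with `N₁ ⊔ ker f = ⊤` and `ker f = K₂ ⊔ N₀`: the face
`S₃ ⧸ ⟪N₀ ∪ K₂⟫ ≅ F_1 ≅ ℤ` (`free_pairQuotient 0 2`, `FreeGroup.mulEquivIntOfUnique`),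
`ker f = ⟪N₀ ∪ K₂⟫ = N₀ ⊔ K₂` (both normal), and `N₀ ⊔ N₁ ⊔ K₂ ⊇ ⟪⋃ Kᵢ⟫ = ⊤` since the
triple quotient is trivial. [cite: AbramsGayKirby2018, Def. 1] -/
theorem stub_faceCharOfTrisection :
    ∀ K : TrisectionKernels 3, IsGroupTrisection 3 1 (PUnit : Type) K →
      K 0 = s4Kernels 0 → K 1 = s4Kernels 1 →
      ∃ f : SurfaceGroup 3 →* Multiplicative ℤ,
        f (SurfaceGroup.a 0) = 1 ∧ f (SurfaceGroup.a 1) = 1 ∧ f (SurfaceGroup.b 2) = 1 ∧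
        Function.Surjective f ∧ s4Kernels 1 ⊔ f.ker = ⊤ ∧ f.ker = K 2 ⊔ s4Kernels 0 := by
  intro K hK h0 h1
  haveI : (K 0).Normal := hK.normal 0
  haveI : (K 2).Normal := hK.normal 2
  haveI : (s4Kernels 0).Normal := s4Kernels_isGroupTrisection_holds.normal 0
  haveI : (s4Kernels 1).Normal := s4Kernels_isGroupTrisection_holds.normal 1
  obtain ⟨e⟩ := hK.free_pairQuotient 0 2 (by decide)
  -- `⟪N₀ ∪ K₂⟫ = K₂ ⊔ N₀`
  have hN : normalClosure ((K 0 : Set (SurfaceGroup 3)) ∪ K 2) = K 2 ⊔ s4Kernels 0 := by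
    rw [faceChar_normalClosure_union_eq_sup, h0, sup_comm]
  -- `⟪⋃ Kᵢ⟫ = ⊤`
  have hTop : normalClosure (⋃ i, (K i : Set (SurfaceGroup 3))) = ⊤ :=
    faceChar_normalClosure_iUnion_eq_top K hK.triple
  -- the face character `S₃ ↠ S₃ ⧸ ⟪N₀ ∪ K₂⟫ ≅ F_1 ≅ ℤ`
  let E : K.pairQuotient 0 2 ≃* Multiplicative ℤ := e.symm.trans FreeGroup.mulEquivIntOfUnique
  have hker : ((E : K.pairQuotient 0 2 →* Multiplicative ℤ).comp
      (QuotientGroup.mk' (normalClosure ((K 0 : Set (SurfaceGroup 3)) ∪ K 2)))).ker =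
        K 2 ⊔ s4Kernels 0 := by
    rw [MonoidHom.ker_mulEquiv_comp, QuotientGroup.ker_mk', hN]
  have hle : s4Kernels 0 ≤ ((E : K.pairQuotient 0 2 →* Multiplicative ℤ).comp
      (QuotientGroup.mk' (normalClosure ((K 0 : Set (SurfaceGroup 3)) ∪ K 2)))).ker := by
    rw [hker]
    exact le_sup_right
  refine ⟨(E : K.pairQuotient 0 2 →* Multiplicative ℤ).comp
    (QuotientGroup.mk' (normalClosure ((K 0 : Set (SurfaceGroup 3)) ∪ K 2))),
    ?_, ?_, ?_, ?_, ?_, hker⟩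
  · exact MonoidHom.mem_ker.1 (hle (of_mem_s4Kernels 0 (x := ((0 : Fin 3), false)) (by decide)))
  · exact MonoidHom.mem_ker.1 (hle (of_mem_s4Kernels 0 (x := ((1 : Fin 3), false)) (by decide)))
  · exact MonoidHom.mem_ker.1 (hle (of_mem_s4Kernels 0 (x := ((2 : Fin 3), true)) (by decide)))
  · exact E.surjective.comp (QuotientGroup.mk'_surjective _)
  · rw [hker, eq_top_iff]
    refine hTop.ge.trans (normalClosure_le_normal (Set.iUnion_subset fun i => ?_))
    refine SetLike.coe_subset_coe.2 ?_
    fin_cases i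
    · exact h0.le.trans (le_sup_right.trans le_sup_right)
    · exact h1.le.trans le_sup_left
    · exact le_sup_left.trans le_sup_right

end Summit.SmoothPoincare4.SmoothPoincare4.Theorems.ShadowsStandard.PowerTwistAbsorption

end
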